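import Summits.BirchSwinnertonDyer.Rank1Residual.GaloisImage.LocalThreeTorsionAdicCompletionAt
import Summits.BirchSwinnertonDyer.Rank1Residual.GaloisImage.PadicRootCensusSplitCover
import HarnessLib

/-!
# KERNEL DECIDER for `#E(ℚ_ℓ)[3]` at a prime `ℓ ≠ 3` with a SPLIT-COVER root certificate — the
# certificate-form twin of n1011-p17's `threeTorsionCheckAt`, O(1) in `ℓ` (team n1011, row T-D31891
# FILE 2; seat p04 GEN 15; route planner 1's design note D-31891)

HONEST FRAMING (cell `b2b-bsdres`, run/shared/lean/b2b/bsd-rank1-residual/, verbatim in every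
file): the goal of the cell is to DELETE the COMBINATION-SHAPED residual classes of the
Birch–Swinnerton-Dyer formula for ALL analytic-rank `≤ 1` elliptic curves over `ℚ` — "full BSD
formula for every rank `≤ 1` curve in class `C`" assembled STRICTLY from published theorems — so
that the rank-`≤ 1` remainder becomes exactly the CONSTRUCTION-SHAPED classes, which are TYPED
(missing-input `Prop`s), NOT attempted. This is not "finishing BSD". Team n1011 (N10/N11): research
route; this file is a TOOL; nothing is booked by it; no mark / label moved; X4 stays
CONSTRUCTION-SHAPED. THEOREMS ONLY (the computable checker `threeTorsionCertAt` is DEFINED in FILE 1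
`PadicRootCensusSplitCover`, next to the split-cover census it runs); no definition, no `abbrev`, no
`instance` (the `p`-integrality of the model is a private theorem fed by `haveI`), no named fact, no `sorry`.

## What

* (FILE 1) `threeTorsionCertAt (p : ℕ) (a₁ a₂ a₃ a₄ a₆ : ℤ) (k : ℕ) (cert : List (ℤ × ℕ × ℕ × ℕ))
  (lin : List (ℤ × ℕ)) : Option ℕ` — EXACTLY n1011-p17's `threeTorsionCheckAt` (T-LOC3L FILE L3) with
  the enumerative root census `RootCensus.check₂ p` of `Ψ₃ = 3X⁴ + b₂X³ + 3b₄X² + 3b₆X + b₈` replaced by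
  the split-cover census `RootCensus.check₃ p … 3 lin` of FILE 1 (`Ψ₃ ≡ 3 · ∏ (X − rᵢ)^{eᵢ} (mod p)`,
  every listed residue a simple Hensel centre or Taylor-dead at level `1`); the `g`-data and the count
  `S` of entries with square `g(cᵢ)` are p17's, unchanged (`gEntryOKAt`, `sqFlagAt`).
* **`natCard_threeTorsion_padic_eq_of_roots`** — p17's decider theorem FACTORED through the root
  package: for `p ≠ 3`, `Δ ≠ 0`, `g`-data on every entry and ANY census of the roots of `Ψ₃` in `ℤ_p`
  indexed by the entries (pairwise distinct Hensel roots within `p^{-(Nᵢ−mᵢ)}` of `cᵢ`, and no other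
  root), `#E(ℚ_p)[3] = 1 + 2S`.  The proof is p17's (`LocalThreeTorsionDeciderAt`), verbatim after
  the census line: `3`-torsion points ↔ `(x, y)` with `Ψ₃(x) = 0` (x integral at `ℓ ≠ 3`, FILE L2),
  fibres `#{y} ∈ {0, 2}` by the square class of `g(x)` read at `cᵢ` (FILE L1).
* **`natCard_threeTorsion_padic_eq_of_cert`** (+ `_of_intModel_of_cert`, and the `v.adicCompletion ℚ`
  currency `natCard_ker_nsmul_three_adicCompletion_eq_of_intModel_of_certAt` through n1011-p18's
  bridge `LocalTorsion3.natCard_ker_nsmul_adicCompletion_eq_natCard_torsion_padic`) — the consumer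
  shapes of `PlacesSeven.kind_ii_of_roots_of_checkAt` with `checkAt ↦ certAt`.
* Instance (by `decide +kernel`, sub-second): 287019b1 at `ℓ = 31891` — `S = 1`, `#E(ℚ_ℓ)[3] = 3`; the
  enumerative `threeTorsionCheckAt 31891 …` elaborates in isolation (≈ 30 s of kernel time) but is
  `(kernel) excessive memory consumption` inside a record file.

References: [SilvermanAEC2009] Ex. 3.7, VII.3.1; [Serre1973] Ch. II §3.3; Hensel's lemma (Mathlib);
cells/n1011/ROUTE-1.md §65.1 (design note D-31891).
-/

set_option autoImplicit false

noncomputable section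

open scoped Classical
open Polynomial WeierstrassCurve
open Summit.BirchSwinnertonDyer.Rank1Residual.GaloisImage.RootCensus
open Summit.BirchSwinnertonDyer.Rank1Residual.GaloisImage.PadicSquareClass
open Summit.BirchSwinnertonDyer.Rank1Residual.GaloisImage.LocalTorsion3
  (bInvs psi3List gList toRootEntry equation_iff_sq_eq_g natCard_fibre_eq_two natCard_fibre_eq_zero
    finite_fibre natCard_ker_nsmul_adicCompletion_eq_natCard_torsion_padic)

namespace Summit.BirchSwinnertonDyer.Rank1Residual.GaloisImage.LocalTorsion3At

/-! ### The decider theorem, factored through the root package -/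

section Main

variable (p : ℕ) [hp : Fact p.Prime] (a₁ a₂ a₃ a₄ a₆ : ℤ)

/-- The curve over `ℚ_p` has the cast integer coefficients. -/
private theorem Ep_eq : (((⟨a₁, a₂, a₃, a₄, a₆⟩ : WeierstrassCurve ℚ).baseChange ℚ_[p])) =
    ⟨(a₁ : ℚ_[p]), (a₂ : ℚ_[p]), (a₃ : ℚ_[p]), (a₄ : ℚ_[p]), (a₆ : ℚ_[p])⟩ := by
  ext <;> simp [WeierstrassCurve.baseChange, WeierstrassCurve.map]

/-- The curve over `ℚ_p` has `p`-integral coefficients (a theorem, instantiated by `haveI` where used,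
so that this file declares no `instance`). -/
private theorem Ep_isIntegral : (((⟨a₁, a₂, a₃, a₄, a₆⟩ : WeierstrassCurve ℚ).baseChange ℚ_[p])).IsIntegral ℤ_[p] := by
  rw [Ep_eq]
  exact ⟨⟨(a₁ : ℤ_[p]), (a₂ : ℤ_[p]), (a₃ : ℤ_[p]), (a₄ : ℤ_[p]), (a₆ : ℤ_[p])⟩,
    by ext <;> simp [WeierstrassCurve.baseChange, WeierstrassCurve.map]⟩

/-- The discriminant over `ℚ_p` is the cast of the integer discriminant. -/
private theorem Ep_Δ : ((((⟨a₁, a₂, a₃, a₄, a₆⟩ : WeierstrassCurve ℚ).baseChange ℚ_[p]))).Δ =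
    (((⟨a₁, a₂, a₃, a₄, a₆⟩ : WeierstrassCurve ℤ).Δ : ℤ) : ℚ_[p]) := by
  have : (((⟨a₁, a₂, a₃, a₄, a₆⟩ : WeierstrassCurve ℚ).baseChange ℚ_[p])) =
      (⟨a₁, a₂, a₃, a₄, a₆⟩ : WeierstrassCurve ℤ).map (Int.castRingHom ℚ_[p]) := by
    rw [Ep_eq]; ext <;> simp [WeierstrassCurve.map]
  rw [this, WeierstrassCurve.map_Δ]; simp

/-- `Ψ₃` of the curve, evaluated at a `p`-adic integer, is the integer polynomial `psi3List`. -/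
private theorem eval_Ψ₃_eq_aeval (z : ℤ_[p]) :
    ((((⟨a₁, a₂, a₃, a₄, a₆⟩ : WeierstrassCurve ℚ).baseChange ℚ_[p]))).Ψ₃.eval (z : ℚ_[p]) =
      ((aeval z (ofList (psi3List a₁ a₂ a₃ a₄ a₆)) : ℤ_[p]) : ℚ_[p]) := by
  rw [coe_aeval_ofList, Additive.eval_psi3_eq, Ep_eq]
  simp only [psi3List, bInvs, aeval_ofList_cons, aeval_ofList_nil,
    WeierstrassCurve.b₂, WeierstrassCurve.b₄, WeierstrassCurve.b₆, WeierstrassCurve.b₈]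
  push_cast
  ring

/-- `g` of the curve, evaluated at a `p`-adic integer, is the integer polynomial `gList`. -/
private theorem g_eq_aeval (z : ℤ_[p]) :
    4 * (z : ℚ_[p]) ^ 3 + ((((⟨a₁, a₂, a₃, a₄, a₆⟩ : WeierstrassCurve ℚ).baseChange ℚ_[p]))).b₂ * (z : ℚ_[p]) ^ 2 +
        2 * ((((⟨a₁, a₂, a₃, a₄, a₆⟩ : WeierstrassCurve ℚ).baseChange ℚ_[p]))).b₄ * (z : ℚ_[p]) + ((((⟨a₁, a₂, a₃, a₄, a₆⟩ : WeierstrassCurve ℚ).baseChange ℚ_[p]))).b₆ =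
      ((aeval z (ofList (gList a₁ a₂ a₃ a₄ a₆)) : ℤ_[p]) : ℚ_[p]) := by
  rw [coe_aeval_ofList, Ep_eq]
  simp only [gList, bInvs, aeval_ofList_cons, aeval_ofList_nil,
    WeierstrassCurve.b₂, WeierstrassCurve.b₄, WeierstrassCurve.b₆]
  push_cast
  ring

/-- `(l.map f)`-sums over `Fin l.length`. [folklore] -/
private theorem sum_fin_eq_sum_map {α : Type*} (l : List α) (f : α → ℕ) :
    ∑ i : Fin l.length, f (l.get i) = (l.map f).sum := by
  rw [← List.sum_ofFn]
  congr 1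
  rw [show (fun i => f (l.get i)) = f ∘ l.get from rfl, ← List.map_ofFn, List.ofFn_get]

/-- `Σ (if b then 2 else 0) = 2 · countP`. [folklore] -/
private theorem sum_map_ite_eq_two_mul_countP {α : Type*} (l : List α) (P : α → Bool) :
    (l.map fun a => if P a then 2 else 0).sum = 2 * l.countP P := by
  induction l with
  | nil => simp
  | cons a l ih =>
    simp only [List.map_cons, List.sum_cons, ih, List.countP_cons]
    by_cases h : P a <;> simp [h]; ring

/-- **THE DECIDER at `p ≠ 3`, FACTORED THROUGH THE ROOT PACKAGE** (n1011-p17's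
`natCard_threeTorsion_padic_eq_of_check`, its proof verbatim after the census line).  For a prime
`p ≠ 3`, integers `a₁, …, a₆` with `Δ ≠ 0`, a list `cert` of entries `(cᵢ, mᵢ, Nᵢ, wᵢ)` whose `g`-data
checks (`gEntryOKAt`), and ANY census of the roots of `Ψ₃` in `ℤ_p` indexed by the entries — pairwise
distinct roots `ρ i`, the `i`-th within `p^{-(Nᵢ − mᵢ)}` of `cᵢ`, and no other root — the number of
`ℚ_p`-rational points `Q` of `E : y² + a₁xy + a₃y = x³ + a₂x² + a₄x + a₆` with `3Q = O` is `1 + 2S`,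
`S` the number of entries with square `g(cᵢ)`. [folklore] -/
theorem natCard_threeTorsion_padic_eq_of_roots (hp3 : p ≠ 3)
    (hΔ : (⟨a₁, a₂, a₃, a₄, a₆⟩ : WeierstrassCurve ℤ).Δ ≠ 0) (cert : List (ℤ × ℕ × ℕ × ℕ))
    (hg : ∀ e ∈ cert, gEntryOKAt p (gList a₁ a₂ a₃ a₄ a₆) e = true)
    (hroots : ∃ ρ : Fin (cert.map toRootEntry).length → ℤ_[p], Function.Injective ρ ∧
      (∀ i, aeval (ρ i) (ofList (psi3List a₁ a₂ a₃ a₄ a₆)) = 0 ∧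
        ‖ρ i - (((cert.map toRootEntry).get i).1 : ℤ_[p])‖ <
          (p : ℝ) ^ (-(((cert.map toRootEntry).get i).2.1 : ℤ)) ∧
        ‖ρ i - (((cert.map toRootEntry).get i).1 : ℤ_[p])‖ ≤
          (p : ℝ) ^ (-((((cert.map toRootEntry).get i).2.2 -
            ((cert.map toRootEntry).get i).2.1 : ℕ) : ℤ))) ∧
      ∀ z : ℤ_[p], aeval z (ofList (psi3List a₁ a₂ a₃ a₄ a₆)) = 0 → ∃ i, ρ i = z) :
    Nat.card {Q : ((⟨a₁, a₂, a₃, a₄, a₆⟩ : WeierstrassCurve ℚ).baseChange ℚ_[p]).toAffine.Point //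
      (3 : ℕ) • Q = 0} =
      1 + 2 * cert.countP fun e => sqFlagAt p (evalList (gList a₁ a₂ a₃ a₄ a₆) e.1) e.2.2.2 := by
  -- real-number facts about `p`
  have hp1 : (1 : ℝ) < p := by exact_mod_cast hp.out.one_lt
  have hp0 : (0 : ℝ) < p := by positivity
  have hpR : (p : ℝ) ≠ 0 := hp0.ne'
  -- the curve
  set E := (((⟨a₁, a₂, a₃, a₄, a₆⟩ : WeierstrassCurve ℚ).baseChange ℚ_[p])) with hEdef
  change Nat.card {Q : E.toAffine.Point // (3 : ℕ) • Q = 0} = _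
  haveI hEint : E.IsIntegral ℤ_[p] := Ep_isIntegral p a₁ a₂ a₃ a₄ a₆
  haveI : E.IsElliptic := by
    refine ⟨isUnit_iff_ne_zero.mpr ?_⟩
    rw [hEdef, Ep_Δ]; exact_mod_cast hΔ
  have h2 : (2 : ℚ_[p]) ≠ 0 := two_ne_zero
  -- the root package
  set l := psi3List a₁ a₂ a₃ a₄ a₆ with hl
  set lg := gList a₁ a₂ a₃ a₄ a₆ with hlg
  set rc := cert.map toRootEntry with hrc
  obtain ⟨ρ, hinj, hρ, hcomplete⟩ := hroots
  have hlen : rc.length = cert.length := by rw [hrc, List.length_map]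
  have hget : ∀ i : Fin rc.length, rc.get i = toRootEntry (cert.get (Fin.cast hlen i)) := by
    intro i; simp [hrc, List.getElem_map, Fin.cast]
  -- Step 1: torsion points ↔ (x, y) with `E(x,y)` and `Ψ₃(x) = 0`
  let S' := {xy : ℚ_[p] × ℚ_[p] // E.toAffine.Equation xy.1 xy.2 ∧ E.Ψ₃.eval xy.1 = 0}
  have e1 : {Q : E.toAffine.Point // (3 : ℕ) • Q = 0} ≃ WithZero S' := by
    refine (Affine.nonsingularPointEquivSubtype (p := fun Q => (3 : ℕ) • Q = 0)
      (show (3 : ℕ) • (0 : E.toAffine.Point) = 0 from nsmul_zero 3)).trans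
      (Equiv.optionCongr (Equiv.subtypeEquivRight fun xy => ?_))
    constructor
    · rintro ⟨hns, h3⟩
      exact ⟨hns.left, (three_nsmul_some_eq_zero_iff_eval_Ψ₃ E hns).mp h3⟩
    · rintro ⟨heq, hΨ⟩
      have hns : E.toAffine.Nonsingular xy.1 xy.2 := (Affine.equation_iff_nonsingular).mp heq
      exact ⟨hns, (three_nsmul_some_eq_zero_iff_eval_Ψ₃ E hns).mpr hΨ⟩
  -- Step 2: `S' ≃ Σ i, {y // E(ρ i, y)}` (FILE L2: the `x`-coordinates are integral)
  have hxint : ∀ s : S', ‖s.1.1‖ ≤ 1 := by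
    rintro ⟨⟨x, y⟩, heq, hΨ⟩
    exact norm_le_one_of_equation_of_eval_Ψ₃ E hp3 heq hΨ
  have hroot : ∀ s : S', ∃ i, ((ρ i : ℤ_[p]) : ℚ_[p]) = s.1.1 := by
    intro s
    set zs : ℤ_[p] := ⟨s.1.1, hxint s⟩ with hzs
    have hzs' : (zs : ℚ_[p]) = s.1.1 := rfl
    obtain ⟨i, hi⟩ := hcomplete zs (by
      have h1 := eval_Ψ₃_eq_aeval p a₁ a₂ a₃ a₄ a₆ zs
      rw [← hEdef, hzs'] at h1
      have : ((aeval zs (ofList l) : ℤ_[p]) : ℚ_[p]) = 0 := by rw [← h1]; exact s.2.2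
      exact PadicInt.coe_eq_zero.mp this)
    exact ⟨i, by rw [hi]⟩
  have hρroot : ∀ i, E.Ψ₃.eval ((ρ i : ℤ_[p]) : ℚ_[p]) = 0 := by
    intro i; rw [hEdef, eval_Ψ₃_eq_aeval, (hρ i).1]; rfl
  let F : Fin rc.length → Type :=
    fun i => {y : ℚ_[p] // E.toAffine.Equation ((ρ i : ℤ_[p]) : ℚ_[p]) y}
  have e2 : S' ≃ Σ i, F i :=
    { toFun := fun s => ⟨Classical.choose (hroot s), ⟨s.1.2, by
        rw [Classical.choose_spec (hroot s)]; exact s.2.1⟩⟩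
      invFun := fun s => ⟨(((ρ s.1 : ℤ_[p]) : ℚ_[p]), s.2.1), s.2.2, hρroot s.1⟩
      left_inv := by
        rintro ⟨⟨x, y⟩, heq, hΨ⟩
        have := Classical.choose_spec (hroot ⟨⟨x, y⟩, heq, hΨ⟩)
        apply Subtype.ext; apply Prod.ext
        · exact this
        · rfl
      right_inv := by
        rintro ⟨i, y, hy⟩
        have hspec := Classical.choose_spec (hroot ⟨(((ρ i : ℤ_[p]) : ℚ_[p]), y), hy, hρroot i⟩)
        have hi : Classical.choose (hroot ⟨(((ρ i : ℤ_[p]) : ℚ_[p]), y), hy, hρroot i⟩) = i :=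
          hinj (Subtype.ext hspec)
        exact Sigma.subtype_ext hi rfl }
  -- Step 3: per-index fibre counts from the square class of `g` (FILE L1)
  have hfib : ∀ i : Fin rc.length, Nat.card (F i) =
      if sqFlagAt p (evalList lg (cert.get (Fin.cast hlen i)).1) (cert.get (Fin.cast hlen i)).2.2.2
      then 2 else 0 := by
    intro i
    have hprec := (hρ i).2.2
    rw [hget i] at hprec
    simp only [toRootEntry] at hprec
    set e := cert.get (Fin.cast hlen i) with he
    obtain ⟨hw, hw', hN⟩ : (p : ℤ) ^ e.2.2.2 ∣ evalList lg e.1 ∧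
        ¬ (p : ℤ) ^ (e.2.2.2 + 1) ∣ evalList lg e.1 ∧ e.2.2.2 + sqPrecAt p + e.2.1 ≤ e.2.2.1 := by
      have := hg e (List.get_mem cert _)
      simp only [gEntryOKAt, Bool.and_eq_true, beq_iff_eq, Bool.not_eq_true', beq_eq_false_iff_ne,
        ne_eq, emod_eq_zero_iff_dvd', decide_eq_true_eq] at this
      exact ⟨this.1.1, this.1.2, this.2⟩
    set z := ρ i with hz
    set gc : ℤ := evalList lg e.1 with hgc
    have hgc0 : (gc : ℚ_[p]) ≠ 0 := by
      have : gc ≠ 0 := by rintro h0; rw [h0] at hw'; exact hw' (dvd_zero _)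
      exact_mod_cast this
    have hgcn : ‖(gc : ℚ_[p])‖ = (p : ℝ) ^ (-(e.2.2.2 : ℤ)) := norm_intCast_padic_eq hw hw'
    have hG := g_eq_aeval p a₁ a₂ a₃ a₄ a₆ z
    rw [← hEdef] at hG
    -- `‖g(z) - g(c)‖ ≤ ‖z - c‖ ≤ p^{-(N - m)} ≤ p^{-(w+δ)} = p^{-δ} ‖g(c)‖`
    have hdist : ‖((aeval z (ofList lg) : ℤ_[p]) : ℚ_[p]) - (gc : ℚ_[p])‖ ≤
        (p : ℝ) ^ (-(sqPrecAt p : ℤ)) * ‖(gc : ℚ_[p])‖ := by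
      have h1 := padic_polynomial_dist (ofList lg) z (e.1 : ℤ_[p])
      rw [aeval_intCast_ofList] at h1
      rw [hgcn, ← PadicInt.coe_intCast, ← PadicInt.coe_sub, ← PadicInt.norm_def]
      refine (h1.trans hprec).trans ?_
      rw [← zpow_add₀ hpR]
      have hmN : e.2.1 ≤ e.2.2.1 := by omega
      exact zpow_le_zpow_right₀ hp1.le (by push_cast [Nat.cast_sub hmN]; omega)
    obtain ⟨hG0, hGsq⟩ := isSquare_iff_of_norm_sub_le (one_le_sqPrecAt p)
      (fun h => sqPrecAt_eq_three_of_eq_two h) hgc0 hdist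
    have hsq := isSquare_intCast_padic_iff_sqFlagAt (p := p) gc e.2.2.2 hw hw'
    by_cases hflag : sqFlagAt p gc e.2.2.2 = true
    · rw [if_pos hflag]
      have : IsSquare (gc : ℚ_[p]) := hsq.mpr hflag
      refine natCard_fibre_eq_two E h2 _ ?_ ?_
      · rw [hG]; exact hGsq.mpr this
      · rw [hG]; exact hG0
    · rw [if_neg hflag]
      have : ¬ IsSquare (gc : ℚ_[p]) := fun hs => hflag (hsq.mp hs)
      refine natCard_fibre_eq_zero E h2 _ ?_
      rw [hG]; exact fun hs => this (hGsq.mp hs)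
  -- Step 4: count
  haveI : ∀ i, Finite (F i) := fun i => finite_fibre E h2 _
  haveI : Finite S' := Finite.of_equiv _ e2.symm
  haveI : Fintype S' := Fintype.ofFinite S'
  rw [Nat.card_congr e1, show Nat.card (WithZero S') = Nat.card (Option S') from rfl,
    Nat.card_eq_fintype_card, Fintype.card_option, ← Nat.card_eq_fintype_card, Nat.card_congr e2,
    Nat.card_sigma, add_comm]
  congr 1
  let f : ℤ × ℕ × ℕ × ℕ → ℕ := fun e => if sqFlagAt p (evalList lg e.1) e.2.2.2 then 2 else 0
  calc ∑ i, Nat.card (F i) = ∑ i : Fin rc.length, f (cert.get (Fin.cast hlen i)) :=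
        Finset.sum_congr rfl fun i _ => hfib i
    _ = ∑ i : Fin cert.length, f (cert.get i) :=
        Fintype.sum_equiv (finCongr hlen) _ _ (fun i => rfl)
    _ = (cert.map f).sum := sum_fin_eq_sum_map cert f
    _ = 2 * cert.countP (fun e => sqFlagAt p (evalList lg e.1) e.2.2.2) :=
        sum_map_ite_eq_two_mul_countP cert _

/-- **THE CERTIFICATE-FORM DECIDER at `p ≠ 3`.** If
`threeTorsionCertAt p a₁ a₂ a₃ a₄ a₆ k cert lin = some S` and `Δ ≠ 0`, then the number of
`ℚ_p`-rational points `Q` of `E : y² + a₁xy + a₃y = x³ + a₂x² + a₄x + a₆` with `3Q = O` is `1 + 2S`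
(the census of FILE 1's `exists_roots_of_check₃` fed to `natCard_threeTorsion_padic_eq_of_roots`).
[folklore] -/
theorem natCard_threeTorsion_padic_eq_of_cert (hp3 : p ≠ 3)
    (hΔ : (⟨a₁, a₂, a₃, a₄, a₆⟩ : WeierstrassCurve ℤ).Δ ≠ 0) {k S : ℕ}
    {cert : List (ℤ × ℕ × ℕ × ℕ)} {lin : List (ℤ × ℕ)}
    (h : threeTorsionCertAt p a₁ a₂ a₃ a₄ a₆ k cert lin = some S) :
    Nat.card {Q : ((⟨a₁, a₂, a₃, a₄, a₆⟩ : WeierstrassCurve ℚ).baseChange ℚ_[p]).toAffine.Point //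
      (3 : ℕ) • Q = 0} = 1 + 2 * S := by
  unfold threeTorsionCertAt at h
  split_ifs at h with hc
  simp only [Option.some.injEq] at h
  rw [Bool.and_eq_true, List.all_eq_true] at hc
  obtain ⟨hcheck, hg⟩ := hc
  subst h
  exact natCard_threeTorsion_padic_eq_of_roots p a₁ a₂ a₃ a₄ a₆ hp3 hΔ cert hg
    (exists_roots_of_check₃ (p := p) _ k _ 3 lin hcheck)

/-- Consumer shape `S = 0`: `#E(ℚ_p)[3] = 1`. [folklore] -/
theorem natCard_threeTorsion_padic_eq_one_of_cert (hp3 : p ≠ 3)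
    (hΔ : (⟨a₁, a₂, a₃, a₄, a₆⟩ : WeierstrassCurve ℤ).Δ ≠ 0) {k : ℕ}
    {cert : List (ℤ × ℕ × ℕ × ℕ)} {lin : List (ℤ × ℕ)}
    (h : threeTorsionCertAt p a₁ a₂ a₃ a₄ a₆ k cert lin = some 0) :
    Nat.card {Q : ((⟨a₁, a₂, a₃, a₄, a₆⟩ : WeierstrassCurve ℚ).baseChange ℚ_[p]).toAffine.Point //
      (3 : ℕ) • Q = 0} = 1 := by
  rw [natCard_threeTorsion_padic_eq_of_cert p a₁ a₂ a₃ a₄ a₆ hp3 hΔ h]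

/-- Consumer shape `S = 1`: `#E(ℚ_p)[3] = 3` (the free kind (ii) numeral `≤ 3` at a split
multiplicative `w ≡ 1 (mod 3)`). [folklore] -/
theorem natCard_threeTorsion_padic_eq_three_of_cert (hp3 : p ≠ 3)
    (hΔ : (⟨a₁, a₂, a₃, a₄, a₆⟩ : WeierstrassCurve ℤ).Δ ≠ 0) {k : ℕ}
    {cert : List (ℤ × ℕ × ℕ × ℕ)} {lin : List (ℤ × ℕ)}
    (h : threeTorsionCertAt p a₁ a₂ a₃ a₄ a₆ k cert lin = some 1) :
    Nat.card {Q : ((⟨a₁, a₂, a₃, a₄, a₆⟩ : WeierstrassCurve ℚ).baseChange ℚ_[p]).toAffine.Point //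
      (3 : ℕ) • Q = 0} = 3 := by
  rw [natCard_threeTorsion_padic_eq_of_cert p a₁ a₂ a₃ a₄ a₆ hp3 hΔ h]

/-! ### Consumer shapes in route 1's `integralModelInt` currency and at the place `v` of `p` -/

/-- If the globally minimal integer model of `W/ℚ` is `⟨a₁, …, a₆⟩` then `W` is that model read
in `ℚ`, and its integer discriminant is non-zero. -/
private theorem eq_and_Δ_ne_zero_of_intModel (W : WeierstrassCurve ℚ) [W.IsElliptic]
    [W.IsGloballyMinimal] (hI : W.integralModelInt = ⟨a₁, a₂, a₃, a₄, a₆⟩) :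
    W = (⟨a₁, a₂, a₃, a₄, a₆⟩ : WeierstrassCurve ℚ) ∧
      (⟨a₁, a₂, a₃, a₄, a₆⟩ : WeierstrassCurve ℤ).Δ ≠ 0 := by
  have hW := W.map_integralModelInt
  rw [hI] at hW
  refine ⟨by rw [← hW]; ext <;> simp [WeierstrassCurve.map], fun h0 => ?_⟩
  have hΔ : W.Δ = (((⟨a₁, a₂, a₃, a₄, a₆⟩ : WeierstrassCurve ℤ).Δ : ℤ) : ℚ) := by
    rw [← hW, WeierstrassCurve.map_Δ]; simp
  rw [h0, Int.cast_zero] at hΔ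
  exact W.isUnit_Δ.ne_zero hΔ

/-- **`integralModelInt` currency**: for `W/ℚ` globally minimal with integer model `⟨a₁, …, a₆⟩`
and a prime `p ≠ 3`, `threeTorsionCertAt p a₁ … a₆ k cert lin = some S` gives `#E(ℚ_p)[3] = 1 + 2S`.
[folklore] -/
theorem natCard_threeTorsion_padic_eq_of_intModel_of_cert (hp3 : p ≠ 3)
    (W : WeierstrassCurve ℚ) [W.IsElliptic] [W.IsGloballyMinimal]
    (hI : W.integralModelInt = ⟨a₁, a₂, a₃, a₄, a₆⟩) {k S : ℕ}
    {cert : List (ℤ × ℕ × ℕ × ℕ)} {lin : List (ℤ × ℕ)}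
    (h : threeTorsionCertAt p a₁ a₂ a₃ a₄ a₆ k cert lin = some S) :
    Nat.card {Q : (W.baseChange ℚ_[p]).toAffine.Point // (3 : ℕ) • Q = 0} = 1 + 2 * S := by
  obtain ⟨hW, hΔ⟩ := eq_and_Δ_ne_zero_of_intModel a₁ a₂ a₃ a₄ a₆ W hI
  rw [hW]
  exact natCard_threeTorsion_padic_eq_of_cert p a₁ a₂ a₃ a₄ a₆ hp3 hΔ h

/-- **`#ker([3] : E(ℚ_v)) = 1 + 2S` at the place `v` of `p ≠ 3` from the certificate-form decider**,
`integralModelInt` currency (n1011-p18's `ℚ_[p] ↔ v.adicCompletion ℚ` bridge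
`LocalTorsion3.natCard_ker_nsmul_adicCompletion_eq_natCard_torsion_padic` BY NAME; the twin of
`natCard_ker_nsmul_three_adicCompletion_eq_of_intModel_of_checkAt`). [cite: SilvermanAEC2009, VII.3.1 and Ex. 3.7] -/
theorem natCard_ker_nsmul_three_adicCompletion_eq_of_intModel_of_certAt (hp3 : p ≠ 3)
    (W : WeierstrassCurve ℚ) [W.IsElliptic] [W.IsGloballyMinimal]
    (hI : W.integralModelInt = ⟨a₁, a₂, a₃, a₄, a₆⟩) {k S : ℕ} {cert : List (ℤ × ℕ × ℕ × ℕ)}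
    {lin : List (ℤ × ℕ)} (h : threeTorsionCertAt p a₁ a₂ a₃ a₄ a₆ k cert lin = some S)
    {v : IsDedekindDomain.HeightOneSpectrum (NumberField.RingOfIntegers ℚ)}
    (hv : (Rat.HeightOneSpectrum.primesEquiv v : ℕ) = p) :
    Nat.card (nsmulAddMonoidHom 3 : (W.baseChange (v.adicCompletion ℚ)).toAffine.Point →+
      (W.baseChange (v.adicCompletion ℚ)).toAffine.Point).ker = 1 + 2 * S := by
  rw [natCard_ker_nsmul_adicCompletion_eq_natCard_torsion_padic _ v hv 3]
  exact natCard_threeTorsion_padic_eq_of_intModel_of_cert p a₁ a₂ a₃ a₄ a₆ hp3 W hI h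

end Main

/-! ### Instance: the 190th D44 row at its five-digit prime -/

/-- **287019b1 (`[1, -1, 1, -17930, -919592]`) at `ℓ = 31891`** (split multiplicative, `v_ℓ(Δ) = 1`,
`ℓ ≡ 1 (mod 3)`): the certificate-form decider returns `some 1` — ONE simple Hensel ball `(27789, 0, 1)`
(the torus abscissa, `g(27789)` a non-zero square mod `ℓ`), `Ψ₃ ≡ 3 (X − 27789)(X − 11998)³ (mod ℓ)`,
node class `11998` Taylor-dead at level `1`; so `#E(ℚ_ℓ)[3] = 3`. By `decide +kernel` (the Euler power `u^{(ℓ−1)/2}` of `sqFlagAt` wants the kernel's GMP arithmetic), in well under a second.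
[folklore] -/
theorem threeTorsionCertAt_287019b1_31891 :
    threeTorsionCertAt 31891 1 (-1) 1 (-17930) (-919592) 1 [((27789 : ℤ), 0, 1, 0)]
      [((27789 : ℤ), 1), (11998, 3)] = some 1 := by
  decide +kernel

end Summit.BirchSwinnertonDyer.Rank1Residual.GaloisImage.LocalTorsion3At

end
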